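import Mathlib.Geometry.Manifold.SmoothEmbedding
import Mathlib.Geometry.Manifold.Diffeomorph
import Mathlib.Geometry.Manifold.Instances.Real
import Literature.Geometry.Lorentzian.LorentzianMetric
import Literature.Geometry.Lorentzian.Isometry
import Literature.Geometry.Lorentzian.Causality
import Literature.Geometry.Lorentzian.Einstein
import Literature.Geometry.Lorentzian.Hypersurface
import Literature.Geometry.Lorentzian.InitialData
import HarnessLib

-- provenance: harness21/H21/H21/Prelude/Lorentz/Development.lean @ 69461ad (interim HEAD d8f2665); M5 mechanical rewrite
-- D-0014 sorry-free migration + `HasLeviCivita` drift fix (literature-prover-litprove-pool-A-g7-0, 2026-08-13)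
/-!
# Globally hyperbolic developments of initial data; MGHD (trunk G08 = T-LORENTZ, item C13)

Let `X` (informally `Σ`; `Σ` is a Lean token) be a connected `n`-manifold modelled on
`EuclideanSpace ℝ (Fin n)` and `D = (h, k)` an initial data set on `X` (`InitialDataSet`).
A **(globally hyperbolic) development** of `D` is a spacetime `(M, g, τ)` of dimension `n + 1`
together with a smooth embedding `ι : X → M` such that `ι(X)` is a Cauchy hypersurface of
`(M, g, τ)`, the induced metric is `ι^* g = h`, and the second fundamental form of `ι` with
respect to the future unit normal `ν` (sign convention **`K_ν(v, w) = + g(D_v ν, dι w)`**, the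
convention (h) of the outline, on both sides) is `k`. A **vacuum development** moreover
satisfies `Ric(g) = 0`. A development `𝒟₁` **embeds into** `𝒟₂` if there is a smooth
time-orientation preserving isometric open embedding `ψ : M₁ → M₂` with `ψ ∘ ι₁ = ι₂`; a vacuum
development is **maximal** (an **MGHD**) if every vacuum development of the same data embeds into
it. By Choquet-Bruhat–Geroch (1969) an MGHD of vacuum data solving the constraints exists and is
unique up to isometry (stated downstream in `H21/Statements/GR`).

## Main definitions (namespace `Literature.Lorentz`)

* `Development D` (**gr.S14**, 'development'), `VacuumDevelopment D`.
* `Development.EmbedsInto`, `Development.IsIsometricTo`, `Development.EmbedsInto.refl`,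
  `Development.IsIsometricTo.embedsInto` (proved), `Development.embedsInto_trans` (named fact).
* `VacuumDevelopment.IsMaximal`, `VacuumDevelopment.IsMGHD`, `Development.IsMaximalAmong`.

## Mathlib

Mathlib (at the pin) provides `Manifold.IsSmoothEmbedding I J n f` (immersion + topological
embedding, `Mathlib/Geometry/Manifold/SmoothEmbedding.lean`), `Diffeomorph`,
`Topology.IsOpenEmbedding`, `ContMDiff` and the model `𝓡 n`; it has no Lorentzian geometry,
Cauchy surfaces or developments (`rg -i 'cauchy surface|globally hyperbolic|development'
Mathlib/Geometry` finds nothing). Spacetimes, Cauchy surfaces, second fundamental forms,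
isometric immersions, time-orientation preservation and Ricci-flatness are the H21 notions
`Spacetime`, `LorentzianMetric.IsCauchySurface`, `PseudoRiemannianMetric.secondFundamentalForm`,
`PseudoRiemannianMetric.IsIsometricImmersion`, `TimeOrientation.PreservesTimeOrientation`,
`PseudoRiemannianMetric.IsRicciFlat`.

## Design choices

* `[ConnectedSpace X]` is required throughout: `Spacetime` is connected, and a Cauchy surface of
  a connected spacetime is connected, so disconnected (or empty) `X` would have no development
  and the existence statements downstream would be false.
* `Development D extends Spacetime.{u} (n + 1)`: the carrier lives in the universe `u` of `X`,
  and maximality quantifies over developments in that universe (outline, decision (g)).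
* The data fields `embed`, `normal` are honest data; all remaining fields are `Prop`s using the
  accepted H21 predicates verbatim. `induced_h` compares continuous bilinear forms
  (`pullbackBilin ι g = h.inner`), `induced_k` compares algebraic bilinear forms
  (`secondFundamentalForm … = (k y).toLinearMap₁₂ = D.kBilin y`).
* `EmbedsInto` uses a bare map `ψ` with `ContMDiff ∧ IsOpenEmbedding ∧ IsIsometricImmersion ∧
  PreservesTimeOrientation ∧ ψ ∘ ι₁ = ι₂` (Ringström 2009, Def. 16.5; Sbierski 2016, Def. 2.3);
  `IsIsometricTo` asks for a `Diffeomorph` with the same compatibilities (CBG 1969, uniqueness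
  clause).
* Non-vacuum matter models are served by `Development.IsMaximalAmong P` for an arbitrary class
  `P` of developments (e.g. Einstein–Maxwell, Einstein–scalar field developments).
* **Standing hypothesis `[g.HasLeviCivita]` (M5 migration note).** The second fundamental form
  and the Ricci tensor of the accepted `LeviCivita`/`Hypersurface`/`Einstein` API take the
  instance argument `[g.HasLeviCivita]` (the conclusion of the named fact
  `PseudoRiemannianMetric.isCovariantDerivativeOn_leviCivitaFun`, O'Neill 1983, Thm. 3.11).
  The `Prop` fields `Development.induced_k` and `VacuumDevelopment.isRicciFlat` therefore bind
  it: they read "for the Levi-Civita connection of `g` (granted its existence), `K_ν = k`" resp.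
  "`Ric(g) = 0`", exactly as `Kerr.isRicciFlat` in `KerrSchild`; a user holding the named fact
  instantiates them with `HasLeviCivita.of`.
* `IsIsometricTo.embedsInto` and `EmbedsInto.refl` are proved; transitivity
  `embedsInto_trans` is a named fact (D-0014): its time-orientation clause needs the timecone
  lemma "future-directed is transitive along isometries", which rests on the reverse
  Cauchy–Schwarz inequality, itself the named fact `LorentzianMetric.mul_le_sq_of_isTimelike`.

## References

* Y. Choquet-Bruhat, R. Geroch, *Global aspects of the Cauchy problem in general relativity*,
  Comm. Math. Phys. 14 (1969), 329–335 (Theorem p. 331; developments, maximal development).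
* H. Ringström, *The Cauchy Problem in General Relativity*, EMS 2009, Ch. 16, Def. 16.1–16.5
  and Thm. 16.6 (globally hyperbolic development, MGHD).
* J. Sbierski, *On the existence of a maximal Cauchy development for the Einstein equations: a
  dezornification*, Ann. Henri Poincaré 17 (2016), 301–329, Def. 2.2–2.5, Thm. 2.6.
* Y. Choquet-Bruhat, *General Relativity and the Einstein Equations*, OUP 2009, Ch. VI §8.
-/

noncomputable section

open Manifold Bundle Set Topology
open scoped ContDiff

universe u

namespace Literature.Geometry.Lorentzian

variable {n : ℕ} {X : Type u} [TopologicalSpace X] [ChartedSpace (EuclideanSpace ℝ (Fin n)) X]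
  [IsManifold (𝓡 n) ∞ X]

/-- **gr.S14** (development of an initial data set; Choquet-Bruhat 2009 Ch. VI–VII, Ringström
2009 Ch. 16, Def. 16.1–16.3; Choquet-Bruhat–Geroch, CMP 14 (1969)). A **(globally hyperbolic)
development** of the initial data set `D = (h, k)` on the connected `n`-manifold `X`: a spacetime
`(M, g, τ)` of dimension `n + 1` (connected, Hausdorff, second countable, smooth Lorentzian
metric, time orientation) with a smooth embedding `ι = embed : X → M` whose image is a Cauchy
hypersurface, a future unit normal field `ν = normal` along `ι`, such that `ι^* g = h` and the
second fundamental form of `ι` w.r.t. `ν` — sign convention `K_ν(v, w) = + g(D_v ν, dι w)`, the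
same convention as for `D.k` — equals `k`. No field equations are imposed (see
`VacuumDevelopment`). Ringström 2009, Def. 16.1–16.3; Sbierski 2016, Def. 2.2. [cite: ChoquetBruhat2009, Ch. VI–VII  Ringström 2009 Ch. 16  Def] -/
structure Development [ConnectedSpace X] (D : InitialDataSet (𝓡 n) X)
    extends Spacetime.{u} (n + 1) where
  /-- The embedding `ι : X → M` of the data manifold. -/
  embed : X → carrier
  /-- `ι` is a smooth (`C^∞`) embedding. -/
  isSmoothEmbedding : Manifold.IsSmoothEmbedding (𝓡 n) (𝓡 (n + 1)) ∞ embed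
  /-- The image `ι(X)` is a Cauchy hypersurface of `(M, g, τ)`. -/
  isCauchySurface : metric.IsCauchySurface timeOrientation (range embed)
  /-- The future unit normal field `ν` along `ι`. -/
  normal : NormalField (𝓡 (n + 1)) embed
  /-- `ν` is the future-directed unit (timelike) normal of `ι`. -/
  isFutureUnitNormal : metric.IsFutureUnitNormal (𝓡 n) timeOrientation embed normal
  /-- The induced metric is the data metric: `ι^* g = h`. -/
  induced_h : ∀ y : X,
    pullbackBilin (I := 𝓡 (n + 1)) (I' := 𝓡 n) embed metric.val y = D.h.inner y
  /-- The second fundamental form of `ι` w.r.t. `ν` (Levi-Civita connection of `g`, standing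
  hypothesis `[g.HasLeviCivita]`) is the data tensor: `K_ν = k`. -/
  induced_k : ∀ [metric.toPseudoRiemannianMetric.HasLeviCivita] (y : X),
    metric.toPseudoRiemannianMetric.secondFundamentalForm (𝓡 n) embed normal y = D.kBilin y

/-- A **vacuum (globally hyperbolic) development** of the initial data set `D`: a development
whose metric satisfies the Einstein vacuum equations `Ric(g) = 0`. Choquet-Bruhat–Geroch,
CMP 14 (1969), p. 330; Ringström 2009, Def. 16.3; Sbierski 2016, Def. 2.2. [cite: Ringstrom2009, Def. 16.3] -/
structure VacuumDevelopment [ConnectedSpace X] (D : InitialDataSet (𝓡 n) X)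
    extends Development D where
  /-- The Einstein vacuum equations `Ric(g) = 0` (Ricci tensor of the Levi-Civita connection of
  `g`, standing hypothesis `[g.HasLeviCivita]`). -/
  isRicciFlat : ∀ [metric.toPseudoRiemannianMetric.HasLeviCivita],
    metric.toPseudoRiemannianMetric.IsRicciFlat

namespace Development

variable [ConnectedSpace X] {D : InitialDataSet (𝓡 n) X}

/-- The development `𝒟₁` **embeds into** the development `𝒟₂` (of the same data): there is a
smooth map `ψ : M₁ → M₂` which is an open embedding, an isometric immersion `ψ^* g₂ = g₁`,
preserves the time orientations, and is compatible with the embeddings of the data,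
`ψ ∘ ι₁ = ι₂`. Ringström 2009, Def. 16.5; Sbierski 2016, Def. 2.3; Choquet-Bruhat–Geroch 1969,
p. 330 ("extension"). [cite: Ringstrom2009, Def. 16.5] -/
def EmbedsInto (𝒟₁ 𝒟₂ : Development D) : Prop :=
  ∃ ψ : 𝒟₁.carrier → 𝒟₂.carrier,
    ContMDiff (𝓡 (n + 1)) (𝓡 (n + 1)) ∞ ψ ∧ IsOpenEmbedding ψ ∧
      𝒟₁.metric.IsIsometricImmersion 𝒟₂.metric.toPseudoRiemannianMetric ψ ∧
      𝒟₁.timeOrientation.PreservesTimeOrientation ψ 𝒟₂.timeOrientation ∧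
      ψ ∘ 𝒟₁.embed = 𝒟₂.embed

/-- The developments `𝒟₁` and `𝒟₂` (of the same data) are **isometric as developments**: there
is a smooth diffeomorphism `ψ : M₁ ≃ M₂` which is an isometry `ψ^* g₂ = g₁`, preserves the time
orientations and satisfies `ψ ∘ ι₁ = ι₂`. This is the sense in which the maximal globally
hyperbolic development is unique. Choquet-Bruhat–Geroch, CMP 14 (1969), Theorem (p. 331);
Ringström 2009, Thm. 16.6; Sbierski 2016, Thm. 2.6. [cite: Ringstrom2009, Thm. 16.6] -/
def IsIsometricTo (𝒟₁ 𝒟₂ : Development D) : Prop :=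
  ∃ ψ : Diffeomorph (𝓡 (n + 1)) (𝓡 (n + 1)) 𝒟₁.carrier 𝒟₂.carrier ∞,
    𝒟₁.metric.IsIsometry 𝒟₂.metric.toPseudoRiemannianMetric ψ ∧
      𝒟₁.timeOrientation.PreservesTimeOrientation ψ 𝒟₂.timeOrientation ∧
      ψ ∘ 𝒟₁.embed = 𝒟₂.embed

/-- Every development embeds into itself (via the identity). Ringström 2009, Def. 16.5. [cite: Ringstrom2009, Def. 16.5] -/
theorem EmbedsInto.refl (𝒟 : Development D) : 𝒟.EmbedsInto 𝒟 := by
  refine ⟨id, contMDiff_id, IsOpenEmbedding.id, ⟨contMDiff_id, fun y ↦ ?_⟩, fun y ↦ ?_, rfl⟩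
  · rw [pullbackBilin_id]
  · rw [mfderiv_id]
    exact 𝒟.timeOrientation.isFutureDirected_vectorField y

/-- Embedding of developments is transitive: the composite `ψ₂₃ ∘ ψ₁₂` of two embeddings is a
smooth isometric open embedding compatible with the data embeddings (chain rule
`(ψ₂₃ ∘ ψ₁₂)^* g₃ = ψ₁₂^* (ψ₂₃^* g₃)`, `pullbackBilin_comp`), and it preserves time orientation
because a time-orientation preserving isometric immersion maps *every* future-directed causal
vector to a future-directed one (timecones are the two components of the causal cone; O'Neill
1983, Ch. 5, Lemma 5.29 ff., whose reverse Cauchy–Schwarz input is the named fact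
`LorentzianMetric.mul_le_sq_of_isTimelike`). Ringström 2009, Def. 16.5 (embeddings of
developments form a preorder); Sbierski 2016, §2. Named fact (statement only; `D` explicit, the
three developments quantified). [cite: Ringstrom2009, Def. 16.5] -/
def embedsInto_trans (D : InitialDataSet (𝓡 n) X) : Prop :=
  ∀ {𝒟₁ 𝒟₂ 𝒟₃ : Development D}, 𝒟₁.EmbedsInto 𝒟₂ → 𝒟₂.EmbedsInto 𝒟₃ → 𝒟₁.EmbedsInto 𝒟₃

/-- Isometric developments embed into each other (the isometry `ψ` itself is the embedding: a
diffeomorphism is a smooth open embedding, and `ψ^* g₂ = g₁`). Ringström 2009, Def. 16.5. [cite: Ringstrom2009, Def. 16.5] -/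
theorem IsIsometricTo.embedsInto {𝒟₁ 𝒟₂ : Development D} (h : 𝒟₁.IsIsometricTo 𝒟₂) :
    𝒟₁.EmbedsInto 𝒟₂ := by
  obtain ⟨ψ, hiso, hτ, hι⟩ := h
  exact ⟨ψ, ψ.contMDiff, ψ.toHomeomorph.isOpenEmbedding, ⟨ψ.contMDiff, hiso⟩, hτ, hι⟩

/-- The development `𝒟` is **maximal among the developments satisfying `P`**: `𝒟` satisfies `P`
and every development of the same data satisfying `P` embeds into `𝒟`. For `P` = "vacuum" this
is `VacuumDevelopment.IsMaximal`; other matter models (Einstein–Maxwell, Einstein–scalar field,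
…) take `P` = "solves the coupled field equations". Choquet-Bruhat–Geroch, CMP 14 (1969), p. 330;
Ringström 2009, Def. 16.5 (with matter, Ch. 16); Choquet-Bruhat 2009, Ch. VI §8. [cite: Ringstrom2009, Def. 16.5 (with matter  Ch. 16] -/
def IsMaximalAmong (P : Development D → Prop) (𝒟 : Development D) : Prop :=
  P 𝒟 ∧ ∀ 𝒟' : Development D, P 𝒟' → 𝒟'.EmbedsInto 𝒟

end Development

namespace VacuumDevelopment

variable [ConnectedSpace X] {D : InitialDataSet (𝓡 n) X}

/-- The vacuum development `𝒟` of `D` is **maximal**: every vacuum (globally hyperbolic)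
development of the same data `D` (with carrier in the same universe) embeds into `𝒟`,
compatibly with the embeddings of `X`. Choquet-Bruhat–Geroch, CMP 14 (1969), Theorem (p. 331);
Ringström 2009, Def. 16.5; Sbierski 2016, Def. 2.5. [cite: Ringstrom2009, Def. 16.5] -/
def IsMaximal (𝒟 : VacuumDevelopment D) : Prop :=
  ∀ 𝒟' : VacuumDevelopment.{u} D, 𝒟'.toDevelopment.EmbedsInto 𝒟.toDevelopment

/-- `𝒟` is a **maximal globally hyperbolic (vacuum) development (MGHD)** of `D`: synonym of
`VacuumDevelopment.IsMaximal` (global hyperbolicity is built into `Development` through the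
Cauchy-surface field). Choquet-Bruhat–Geroch, CMP 14 (1969); Ringström 2009, Def. 16.5. [cite: Ringstrom2009, Def. 16.5] -/
abbrev IsMGHD (𝒟 : VacuumDevelopment D) : Prop :=
  𝒟.IsMaximal

/-- Maximality of a vacuum development is maximality among the Ricci-flat developments
(`Development.IsMaximalAmong` with `P 𝒟' := Ric(g') = 0`, under the standing hypothesis
`[g'.HasLeviCivita]` as in `VacuumDevelopment.isRicciFlat`). Ringström 2009, Def. 16.5. [cite: Ringstrom2009, Def. 16.5] -/
theorem isMaximal_iff_isMaximalAmong (𝒟 : VacuumDevelopment D) :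
    𝒟.IsMaximal ↔ 𝒟.toDevelopment.IsMaximalAmong
      fun 𝒟' ↦ ∀ [𝒟'.metric.toPseudoRiemannianMetric.HasLeviCivita],
        𝒟'.metric.toPseudoRiemannianMetric.IsRicciFlat := by
  constructor
  · intro h
    exact ⟨𝒟.isRicciFlat, fun 𝒟' h' ↦ h ⟨𝒟', h'⟩⟩
  · rintro ⟨-, h⟩ 𝒟'
    exact h 𝒟'.toDevelopment 𝒟'.isRicciFlat

end VacuumDevelopment

end Literature.Geometry.Lorentzian

end
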